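import Literature.NumberTheory.DiophantineGeometry.RealPlaneCurveBranches
import Mathlib.Analysis.Calculus.IteratedDeriv.Lemmas
import Mathlib.Analysis.Calculus.Deriv.Pow
import Mathlib.Analysis.Calculus.Deriv.Shift
import Mathlib.Algebra.MvPolynomial.Monad
import HarnessLib

/-!
# Bombieri–Pila: implicit derivatives of algebraic functions, level sets, translations

Infrastructure for the proof of Theorem 4 of [BombieriPila1989]:

* `implicitDerivPoly`, `iteratedDeriv_mul_pow_eq`: for a smooth solution `g` of `F(x, g(x)) = 0`
  on an open set, `g^{(k+1)} F_y^{2k+1} = P_k(x, g)` with the polynomials `P_k` of the proof of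
  Lemma 5 of the paper (`P₁ = -F_x`,
  `P_{k+1} = (P_{k,x} F_y - P_{k,y} F_x) F_y - (2k-1) P_k (F_{yx} F_y - F_{yy} F_x)`), and
  `deg P_k ≤ (2k+1) deg F` (`totalDegree_implicitDerivPoly_le`).
* `levelSet_dichotomy` (weak form of Lemma 5): on a branch of the irreducible curve `F = 0`
  either `g^{(k+1)} ≡ c`, or `{g^{(k+1)} = c}` is finite with `≤ (4(k+1)d)⁴` points (weak
  Bézout in place of Bézout's theorem; the paper's bound is `d(d-1)(2k+1)`).
* `translate`: integer (indeed real) translations of the plane, preserving the total degree and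
  absolute irreducibility, and transporting smooth branches (`isSmoothBranch_translate`).

## References

* E. Bombieri, J. Pila, *The number of integral points on arcs and ovals*, Duke Math. J. 59
  (1989) 337–357, Lemma 5 and the proof of Theorem 4 [BombieriPila1989].
-/

namespace Literature.NumberTheory.DiophantineGeometry.Dioph

open scoped ContDiff Topology
open MvPolynomial Filter

/-! ### Chain rule along a curve `x ↦ (x, g x)` -/

/-- Derivative of `x ↦ Q(x, g(x))`. [folklore] -/
theorem hasDerivAt_eval_comp (Q : MvPolynomial (Fin 2) ℝ) {g : ℝ → ℝ} {g' x : ℝ}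
    (hg : HasDerivAt g g' x) :
    HasDerivAt (fun t => MvPolynomial.eval ![t, g t] Q)
      (MvPolynomial.eval ![x, g x] (pderiv 0 Q) + g' * MvPolynomial.eval ![x, g x] (pderiv 1 Q))
      x := by
  have hd : DifferentiableAt ℝ (fun z : ℝ × ℝ => MvPolynomial.eval ![z.1, z.2] Q) (x, g x) :=
    (contDiff_mvEval Q).contDiffAt.differentiableAt (by simp)
  have := hd.hasFDerivAt.comp_hasDerivAt x ((hasDerivAt_id' x).prodMk hg)
  rw [fderiv_mvEval_apply, one_mul] at this
  exact this

/-! ### Iterated derivatives of a smooth function on an open set -/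

section Smooth

variable {g : ℝ → ℝ} {J : Set ℝ} (hJ : IsOpen J) (hg : ContDiffOn ℝ ∞ g J)
include hJ hg

/-- Iterated derivatives of a smooth function on an open set are differentiable there. [folklore] -/
theorem differentiableAt_iteratedDeriv (m : ℕ) {x : ℝ} (hx : x ∈ J) :
    DifferentiableAt ℝ (iteratedDeriv m g) x := by
  have h1 : DifferentiableOn ℝ (iteratedDerivWithin m g J) J :=
    hg.differentiableOn_iteratedDerivWithin (by exact_mod_cast ENat.coe_lt_top m) hJ.uniqueDiffOn
  have h2 : DifferentiableAt ℝ (iteratedDerivWithin m g J) x := h1.differentiableAt (hJ.mem_nhds hx)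
  refine h2.congr_of_eventuallyEq ?_
  filter_upwards [hJ.mem_nhds hx] with t ht
  exact (iteratedDerivWithin_of_isOpen hJ ht).symm

/-- The derivative of the `m`-th iterated derivative is the `(m+1)`-st. [folklore] -/
theorem hasDerivAt_iteratedDeriv (m : ℕ) {x : ℝ} (hx : x ∈ J) :
    HasDerivAt (iteratedDeriv m g) (iteratedDeriv (m + 1) g x) x := by
  rw [iteratedDeriv_succ]
  exact (differentiableAt_iteratedDeriv hJ hg m hx).hasDerivAt

/-- Iterated derivatives of a smooth function on an open set are continuous there. [folklore] -/
theorem continuousOn_iteratedDeriv (m : ℕ) : ContinuousOn (iteratedDeriv m g) J := by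
  have h1 : ContinuousOn (iteratedDerivWithin m g J) J :=
    hg.continuousOn_iteratedDerivWithin (by exact_mod_cast le_top) hJ.uniqueDiffOn
  exact h1.congr fun t ht => (iteratedDerivWithin_of_isOpen hJ ht).symm

end Smooth

/-! ### The polynomials `P_k` with `g^{(k)} F_y^{2k-1} = P_k(x, g)` -/

section ImplicitDerivatives

variable (F : MvPolynomial (Fin 2) ℝ)

/-- The polynomials of implicit differentiation: `implicitDerivPoly F k` is the polynomial `P`
with `g^{(k+1)} · F_y^{2k+1} = P(x, g)` for every smooth solution `g` of `F(x, g(x)) = 0`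
(Bombieri–Pila, proof of Lemma 5: `P₁ = -F_x`,
`P_{k+1} = (P_{k,x} F_y - P_{k,y} F_x) F_y - (2k-1) P_k (F_{yx} F_y - F_{yy} F_x)`).
[cite: BombieriPila1989, proof of Lemma 5] -/
noncomputable def implicitDerivPoly : ℕ → MvPolynomial (Fin 2) ℝ
  | 0 => -pderiv 0 F
  | k + 1 => (pderiv 0 (implicitDerivPoly k) * pderiv 1 F -
        pderiv 1 (implicitDerivPoly k) * pderiv 0 F) * pderiv 1 F -
      C (2 * (k : ℝ) + 1) * implicitDerivPoly k *
        (pderiv 0 (pderiv 1 F) * pderiv 1 F - pderiv 1 (pderiv 1 F) * pderiv 0 F)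

variable {F}

/-- **Implicit differentiation to all orders**: for a smooth `g` on an open set `J` with
`F(x, g(x)) = 0`, one has `g^{(k+1)}(x) · F_y(x, g(x))^{2k+1} = P_k(x, g(x))`.
[cite: BombieriPila1989, proof of Lemma 5] -/
theorem iteratedDeriv_mul_pow_eq {g : ℝ → ℝ} {J : Set ℝ} (hJ : IsOpen J) (hg : ContDiffOn ℝ ∞ g J)
    (hz : ∀ x ∈ J, MvPolynomial.eval ![x, g x] F = 0) (k : ℕ) :
    ∀ x ∈ J, iteratedDeriv (k + 1) g x * MvPolynomial.eval ![x, g x] (pderiv 1 F) ^ (2 * k + 1) =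
      MvPolynomial.eval ![x, g x] (implicitDerivPoly F k) := by
  induction k with
  | zero =>
    intro x hx
    have hgd : HasDerivAt g (deriv g x) x :=
      ((hg.differentiableOn (by simp)).differentiableAt (hJ.mem_nhds hx)).hasDerivAt
    have h := pderiv_add_deriv_mul_pderiv_eq_zero F hgd
      (by filter_upwards [hJ.mem_nhds hx] with t ht; exact hz t ht)
    simp only [implicitDerivPoly, map_neg, zero_add, iteratedDeriv_one, mul_zero, pow_one]
    linarith
  | succ k ih =>
    intro x hx
    -- notation
    set Fx := MvPolynomial.eval ![x, g x] (pderiv 0 F) with hFx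
    set Fy := MvPolynomial.eval ![x, g x] (pderiv 1 F) with hFy
    set Fyx := MvPolynomial.eval ![x, g x] (pderiv 0 (pderiv 1 F)) with hFyx
    set Fyy := MvPolynomial.eval ![x, g x] (pderiv 1 (pderiv 1 F)) with hFyy
    set Pv := MvPolynomial.eval ![x, g x] (implicitDerivPoly F k) with hPv
    set Px := MvPolynomial.eval ![x, g x] (pderiv 0 (implicitDerivPoly F k)) with hPx
    set Py := MvPolynomial.eval ![x, g x] (pderiv 1 (implicitDerivPoly F k)) with hPy
    set u := iteratedDeriv (k + 1) g x with hu
    set u' := iteratedDeriv (k + 2) g x with hu'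
    set g' := deriv g x with hg'
    have hgd : HasDerivAt g g' x :=
      ((hg.differentiableOn (by simp)).differentiableAt (hJ.mem_nhds hx)).hasDerivAt
    -- `F_x + g' F_y = 0`
    have h3 : Fx + g' * Fy = 0 := pderiv_add_deriv_mul_pderiv_eq_zero F hgd
      (by filter_upwards [hJ.mem_nhds hx] with t ht; exact hz t ht)
    -- derivative of `u · F_y^{2k+1}`
    have hdu : HasDerivAt (iteratedDeriv (k + 1) g) u' x := by
      have := hasDerivAt_iteratedDeriv hJ hg (k + 1) hx
      exact this
    have hdFy : HasDerivAt (fun t => MvPolynomial.eval ![t, g t] (pderiv 1 F)) (Fyx + g' * Fyy) x :=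
      hasDerivAt_eval_comp (pderiv 1 F) hgd
    have hdw : HasDerivAt (fun t => MvPolynomial.eval ![t, g t] (pderiv 1 F) ^ (2 * k + 1))
        ((2 * k + 1 : ℕ) * Fy ^ (2 * k) * (Fyx + g' * Fyy)) x := by
      have := hdFy.pow (2 * k + 1)
      refine this.congr_deriv ?_
      rw [hFy, Nat.add_sub_cancel]
    have hdprod := hdu.mul hdw
    -- derivative of `P_k(x, g x)`
    have hdP : HasDerivAt (fun t => MvPolynomial.eval ![t, g t] (implicitDerivPoly F k))
        (Px + g' * Py) x := hasDerivAt_eval_comp _ hgd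
    -- the two functions agree near `x`
    have heq : (fun t => iteratedDeriv (k + 1) g t *
        MvPolynomial.eval ![t, g t] (pderiv 1 F) ^ (2 * k + 1)) =ᶠ[𝓝 x]
        fun t => MvPolynomial.eval ![t, g t] (implicitDerivPoly F k) := by
      filter_upwards [hJ.mem_nhds hx] with t ht
      exact ih t ht
    have h1 : u' * Fy ^ (2 * k + 1) + u * ((2 * k + 1 : ℕ) * Fy ^ (2 * k) * (Fyx + g' * Fyy)) =
        Px + g' * Py := (hdprod.congr_of_eventuallyEq heq.symm).unique hdP
    have h2 : u * Fy ^ (2 * k + 1) = Pv := ih x hx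
    -- conclude
    show u' * Fy ^ (2 * (k + 1) + 1) = MvPolynomial.eval ![x, g x] (implicitDerivPoly F (k + 1))
    simp only [implicitDerivPoly, map_sub, map_mul, MvPolynomial.eval_C]
    rw [← hFx, ← hFy, ← hFyx, ← hFyy, ← hPv, ← hPx, ← hPy]
    push_cast at h1
    have hpow : Fy ^ (2 * (k + 1) + 1) = Fy ^ (2 * k + 1) * Fy ^ 2 := by ring
    rw [hpow]
    linear_combination Fy ^ 2 * h1 - (2 * (k : ℝ) + 1) * (Fyx * Fy - Fyy * Fx) * h2 +
      (Py * Fy - (2 * (k : ℝ) + 1) * u * Fy ^ (2 * k) * Fy * Fyy) * h3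

end ImplicitDerivatives

/-! ### Degrees of the polynomials `P_k` -/

section Degrees

variable (F : MvPolynomial (Fin 2) ℝ)

/-- `deg P_k ≤ (2k+1) deg F`. [folklore] -/
theorem totalDegree_implicitDerivPoly_le (k : ℕ) :
    (implicitDerivPoly F k).totalDegree ≤ (2 * k + 1) * F.totalDegree := by
  induction k with
  | zero =>
    simp only [implicitDerivPoly, totalDegree_neg, mul_zero, zero_add, one_mul]
    exact totalDegree_pderiv_le 0
  | succ k ih =>
    set d := F.totalDegree with hd
    have h0 : ∀ i : Fin 2, (pderiv i F).totalDegree ≤ d := fun i => totalDegree_pderiv_le i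
    have h1 : ∀ i j : Fin 2, (pderiv i (pderiv j F)).totalDegree ≤ d := fun i j =>
      (totalDegree_pderiv_le i).trans (h0 j)
    have hP : ∀ i : Fin 2, (pderiv i (implicitDerivPoly F k)).totalDegree ≤ (2 * k + 1) * d :=
      fun i => (totalDegree_pderiv_le i).trans ih
    simp only [implicitDerivPoly]
    refine (totalDegree_sub _ _).trans (max_le ?_ ?_)
    · refine (totalDegree_mul _ _).trans ?_
      have := (totalDegree_sub (pderiv 0 (implicitDerivPoly F k) * pderiv 1 F)
        (pderiv 1 (implicitDerivPoly F k) * pderiv 0 F)).trans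
        (max_le ((totalDegree_mul _ _).trans (add_le_add (hP 0) (h0 1)))
          ((totalDegree_mul _ _).trans (add_le_add (hP 1) (h0 0))))
      have h2 := h0 1
      calc _ ≤ ((2 * k + 1) * d + d) + d := add_le_add this h2
        _ = (2 * (k + 1) + 1) * d := by ring
    · refine (totalDegree_mul _ _).trans ?_
      have hC : (C (2 * (k : ℝ) + 1) * implicitDerivPoly F k).totalDegree ≤ (2 * k + 1) * d :=
        (totalDegree_mul _ _).trans (by rw [totalDegree_C, zero_add]; exact ih)
      have h3 : (pderiv 0 (pderiv 1 F) * pderiv 1 F - pderiv 1 (pderiv 1 F) * pderiv 0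
        F).totalDegree
          ≤ d + d :=
        (totalDegree_sub _ _).trans (max_le ((totalDegree_mul _ _).trans (add_le_add (h1 0 1) (h0
          1)))
          ((totalDegree_mul _ _).trans (add_le_add (h1 1 1) (h0 0))))
      calc _ ≤ (2 * k + 1) * d + (d + d) := add_le_add hC h3
        _ = (2 * (k + 1) + 1) * d := by ring

end Degrees

/-! ### Level sets of the derivatives of a branch -/

section LevelSets

variable {F : MvPolynomial (Fin 2) ℝ}

/-- A continuous function on an open interval which equals `c` off a finite set equals `c`
everywhere. [folklore] -/
theorem eqOn_of_finite_exceptions {h : ℝ → ℝ} {a b c : ℝ} (hc : ContinuousOn h (Set.Ioo a b))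
    {E : Set ℝ} (hE : E.Finite) (heq : ∀ x ∈ Set.Ioo a b, x ∉ E → h x = c) :
    ∀ x ∈ Set.Ioo a b, h x = c := by
  intro x hx
  by_contra hne
  have hcx : ContinuousAt h x := hc.continuousAt (Ioo_mem_nhds hx.1 hx.2)
  have hev : ∀ᶠ t in 𝓝 x, h t ≠ c := hcx.eventually_ne hne
  obtain ⟨ε, hε, hball⟩ := Metric.eventually_nhds_iff.1 (hev.and (Ioo_mem_nhds hx.1 hx.2))
  -- the ball is infinite, `E` is finite
  have hinf : (Set.Ioo (x - ε) (x + ε)).Infinite := Set.Ioo_infinite (by linarith)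
  obtain ⟨t, ht, htE⟩ := (hinf.sdiff hE).nonempty
  have hdist : dist t x < ε := by
    rw [Real.dist_eq, abs_lt]
    constructor <;> linarith [ht.1, ht.2]
  obtain ⟨hne', htI⟩ := hball hdist
  exact hne' (heq t htI htE)

/-- **Level sets of derivatives of a branch** (weak form of Bombieri–Pila, Lemma 5). Let `g` be a
smooth branch of the irreducible curve `F = 0` (`deg F = d ≥ 2`) over `(a, b)`, `k ≥ 0` and
`c ∈ ℝ`. Then either `g^{(k+1)} ≡ c` on `(a, b)`, or the level set `{g^{(k+1)} = c}` is finite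
with at most `(4(k+1)d)⁴` elements (it lies on the curve `P_k - c F_y^{2k+1} = 0`, which does
not contain `F = 0`; weak Bézout). The paper proves the sharper bound `d(d-1)(2k+1)` for
non-polynomial `g` by Bézout's theorem. [cite: BombieriPila1989, Lemma 5] -/
theorem levelSet_dichotomy (hF : Irreducible F) (hd : 2 ≤ F.totalDegree) {a b : ℝ} {g : ℝ → ℝ}
    (hg : ContDiffOn ℝ ∞ g (Set.Ioo a b)) (hz : ∀ x ∈ Set.Ioo a b, MvPolynomial.eval ![x, g x] F =
      0)
    (k : ℕ) (c : ℝ) :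
    (∀ x ∈ Set.Ioo a b, iteratedDeriv (k + 1) g x = c) ∨
      ({x ∈ Set.Ioo a b | iteratedDeriv (k + 1) g x = c}.Finite ∧
        {x ∈ Set.Ioo a b | iteratedDeriv (k + 1) g x = c}.ncard ≤
          (4 * (k + 1) * F.totalDegree) ^ 4) := by
  set Q := implicitDerivPoly F k - C c * pderiv 1 F ^ (2 * k + 1) with hQ
  have hident := iteratedDeriv_mul_pow_eq (F := F) isOpen_Ioo hg hz k
  -- the level set lies on `Q = 0`
  have hsub : ∀ x ∈ Set.Ioo a b, iteratedDeriv (k + 1) g x = c →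
      MvPolynomial.eval ![x, g x] Q = 0 := by
    intro x hx hxc
    have := hident x hx
    simp only [hQ, map_sub, map_mul, MvPolynomial.eval_C, map_pow]
    rw [← this, hxc, sub_self]
  by_cases hdiv : Q = 0 ∨ F ∣ Q
  · -- `Q` vanishes along the branch: `g^{(k+1)} = c` off the finite set `F_y = 0`
    left
    have hQ0 : ∀ x ∈ Set.Ioo a b, MvPolynomial.eval ![x, g x] Q = 0 := by
      intro x hx
      rcases hdiv with h | ⟨H, hH⟩
      · rw [h, map_zero]
      · rw [hH, map_mul, hz x hx, zero_mul]
    rcases Set.eq_empty_or_nonempty (Set.Ioo a b) with he | ⟨x₀, hx₀⟩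
    · intro x hx
      rw [he] at hx
      exact absurd hx (Set.notMem_empty x)
    have h1 : pderiv 1 F ≠ 0 := fun h1 =>
      eval_ne_zero_of_pderiv_eq_zero hF hd h1 x₀ (g x₀) (hz x₀ hx₀)
    obtain ⟨hZfin, -⟩ := mv_commonZeros_finite_ncard_le hF (not_dvd_pderiv h1)
    set E := Prod.fst '' {p : ℝ × ℝ | MvPolynomial.eval ![p.1, p.2] F = 0 ∧
      MvPolynomial.eval ![p.1, p.2] (pderiv 1 F) = 0} with hE
    have hEfin : E.Finite := hZfin.image _
    refine eqOn_of_finite_exceptions (continuousOn_iteratedDeriv isOpen_Ioo hg (k + 1)) hEfin ?_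
    intro x hx hxE
    have hFy : MvPolynomial.eval ![x, g x] (pderiv 1 F) ≠ 0 := by
      intro h0
      exact hxE ⟨(x, g x), ⟨hz x hx, h0⟩, rfl⟩
    have h2 := hident x hx
    have h3 := hQ0 x hx
    simp only [hQ, map_sub, map_mul, MvPolynomial.eval_C, map_pow] at h3
    have h4 : (iteratedDeriv (k + 1) g x - c) *
        MvPolynomial.eval ![x, g x] (pderiv 1 F) ^ (2 * k + 1) = 0 := by
      rw [sub_mul, h2]
      linarith
    rcases mul_eq_zero.1 h4 with h | h
    · linarith
    · exact absurd (pow_eq_zero_iff (by omega) |>.1 h) hFy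
  · -- the level set lies on the curve `Q = 0`, which meets `F = 0` in finitely many points
    right
    push Not at hdiv
    obtain ⟨hQ0, hndvd⟩ := hdiv
    obtain ⟨hZfin, hZcard⟩ := mv_commonZeros_finite_ncard_le hF hndvd
    set Z := {p : ℝ × ℝ | MvPolynomial.eval ![p.1, p.2] F = 0 ∧
      MvPolynomial.eval ![p.1, p.2] Q = 0} with hZ
    have hsub' : {x ∈ Set.Ioo a b | iteratedDeriv (k + 1) g x = c} ⊆ Prod.fst '' Z := by
      intro x hx
      exact ⟨(x, g x), ⟨hz x hx.1, hsub x hx.1 hx.2⟩, rfl⟩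
    have hfin : (Prod.fst '' Z).Finite := hZfin.image _
    refine ⟨hfin.subset hsub', (Set.ncard_le_ncard hsub' hfin).trans ?_⟩
    refine (Set.ncard_image_le hZfin).trans (hZcard.trans ?_)
    have hdegQ : Q.totalDegree ≤ (2 * k + 1) * F.totalDegree := by
      refine (totalDegree_sub _ _).trans (max_le (totalDegree_implicitDerivPoly_le F k) ?_)
      refine (totalDegree_mul _ _).trans ?_
      rw [totalDegree_C, zero_add]
      exact (totalDegree_pow _ _).trans (Nat.mul_le_mul_left _ (totalDegree_pderiv_le 1))
    have : F.totalDegree + Q.totalDegree ≤ 4 * (k + 1) * F.totalDegree := by nlinarith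
    exact Nat.pow_le_pow_left this 4

end LevelSets

/-! ### Integer translations of the plane -/

section Translate

/-- Translation of the plane: `translate m n F = F(x + m, y + n)`. [folklore] -/
noncomputable def translate (m n : ℝ) (F : MvPolynomial (Fin 2) ℝ) : MvPolynomial (Fin 2) ℝ :=
  bind₁ ![X 0 + C m, X 1 + C n] F

/-- Evaluating the translated polynomial. [folklore] -/
theorem eval_translate (m n : ℝ) (F : MvPolynomial (Fin 2) ℝ) (x y : ℝ) :
    MvPolynomial.eval ![x, y] (translate m n F) = MvPolynomial.eval ![x + m, y + n] F := by
  have hvec : (fun i => eval₂Hom (RingHom.id ℝ) ![x, y] ((![X 0 + C m, X 1 + C n] :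
      Fin 2 → MvPolynomial (Fin 2) ℝ) i)) = ![x + m, y + n] := by
    funext i
    fin_cases i <;> simp
  rw [translate]
  show eval₂Hom (RingHom.id ℝ) ![x, y] (bind₁ _ F) = eval₂Hom (RingHom.id ℝ) _ F
  rw [eval₂Hom_bind₁, hvec]

/-- Translations compose additively. [folklore] -/
theorem translate_translate (m n m' n' : ℝ) (F : MvPolynomial (Fin 2) ℝ) :
    translate m n (translate m' n' F) = translate (m + m') (n + n') F := by
  have h : (bind₁ ![X 0 + C m, X 1 + C n]).comp (bind₁ ![X 0 + C m', X 1 + C n']) =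
      (bind₁ ![X 0 + C (m + m'), X 1 + C (n + n')] :
        MvPolynomial (Fin 2) ℝ →ₐ[ℝ] MvPolynomial (Fin 2) ℝ) := by
    apply algHom_ext
    intro i
    fin_cases i <;> simp [bind₁_X_right, add_assoc]
  exact DFunLike.congr_fun h F

/-- Translation by `(0, 0)` is the identity. [folklore] -/
theorem translate_zero (F : MvPolynomial (Fin 2) ℝ) : translate 0 0 F = F := by
  have h : ((![X 0 + C 0, X 1 + C 0]) : Fin 2 → MvPolynomial (Fin 2) ℝ) = X := by
    funext i; fin_cases i <;> simp
  rw [translate, h, bind₁_X_left]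
  rfl

/-- Translation is an algebra automorphism. [folklore] -/
noncomputable def translateEquiv (m n : ℝ) :
    MvPolynomial (Fin 2) ℝ ≃ₐ[ℝ] MvPolynomial (Fin 2) ℝ :=
  AlgEquiv.ofAlgHom (bind₁ ![X 0 + C m, X 1 + C n]) (bind₁ ![X 0 + C (-m), X 1 + C (-n)])
    (by
      apply algHom_ext
      intro i
      have h := translate_translate m n (-m) (-n) (X i)
      simp only [translate, add_neg_cancel] at h
      rw [AlgHom.comp_apply, h]
      have h0 := translate_zero (X i : MvPolynomial (Fin 2) ℝ)
      rw [translate] at h0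
      rw [h0, AlgHom.id_apply])
    (by
      apply algHom_ext
      intro i
      have h := translate_translate (-m) (-n) m n (X i)
      simp only [translate, neg_add_cancel] at h
      rw [AlgHom.comp_apply, h]
      have h0 := translate_zero (X i : MvPolynomial (Fin 2) ℝ)
      rw [translate] at h0
      rw [h0, AlgHom.id_apply])

/-- `translateEquiv` acts as `translate`. [folklore] -/
theorem translateEquiv_apply (m n : ℝ) (F : MvPolynomial (Fin 2) ℝ) :
    translateEquiv m n F = translate m n F := rfl

/-- Translation does not increase the total degree. [folklore] -/
theorem totalDegree_translate_le (m n : ℝ) (F : MvPolynomial (Fin 2) ℝ) :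
    (translate m n F).totalDegree ≤ F.totalDegree := by
  set v : Fin 2 → MvPolynomial (Fin 2) ℝ := ![X 0 + C m, X 1 + C n] with hv
  have h1 : ∀ i : Fin 2, (v i).totalDegree ≤ 1 := by
    intro i
    fin_cases i <;>
      exact (totalDegree_add _ _).trans (max_le (totalDegree_X _).le (by simp))
  rw [translate, ← hv]
  conv_lhs => rw [F.as_sum]
  rw [map_sum]
  refine totalDegree_finsetSum_le fun s hs => ?_
  rw [bind₁_monomial]
  refine (totalDegree_mul _ _).trans ?_
  rw [totalDegree_C, zero_add]
  refine (totalDegree_finsetProd _ _).trans ?_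
  calc ∑ i ∈ s.support, (v i ^ s i).totalDegree
      ≤ ∑ i ∈ s.support, s i := by
        refine Finset.sum_le_sum fun i _ => (totalDegree_pow _ _).trans ?_
        calc s i * (v i).totalDegree ≤ s i * 1 := Nat.mul_le_mul_left _ (h1 i)
          _ = s i := mul_one _
    _ = s.sum fun _ e => e := rfl
    _ ≤ F.totalDegree := le_totalDegree hs

/-- Translation preserves the total degree. [folklore] -/
theorem totalDegree_translate (m n : ℝ) (F : MvPolynomial (Fin 2) ℝ) :
    (translate m n F).totalDegree = F.totalDegree := by
  refine le_antisymm (totalDegree_translate_le m n F) ?_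
  have := totalDegree_translate_le (-m) (-n) (translate m n F)
  rwa [translate_translate, neg_add_cancel, neg_add_cancel, translate_zero] at this

/-- Translation preserves absolute irreducibility. [folklore] -/
theorem irreducible_map_translate {F : MvPolynomial (Fin 2) ℝ}
    (hF : Irreducible (MvPolynomial.map (algebraMap ℝ ℂ) F)) (m n : ℝ) :
    Irreducible (MvPolynomial.map (algebraMap ℝ ℂ) (translate m n F)) := by
  -- over `ℂ`, translation is again an automorphism
  set e : MvPolynomial (Fin 2) ℂ ≃ₐ[ℂ] MvPolynomial (Fin 2) ℂ :=
    AlgEquiv.ofAlgHom (bind₁ ![X 0 + C (m : ℂ), X 1 + C (n : ℂ)])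
      (bind₁ ![X 0 + C (-(m : ℂ)), X 1 + C (-(n : ℂ))])
      (by apply algHom_ext; intro i; fin_cases i <;> simp [bind₁_X_right, add_assoc])
      (by apply algHom_ext; intro i; fin_cases i <;> simp [bind₁_X_right, add_assoc]) with he
  have hvec : (fun i => MvPolynomial.map (algebraMap ℝ ℂ) ((![X 0 + C m, X 1 + C n] :
      Fin 2 → MvPolynomial (Fin 2) ℝ) i)) = ![X 0 + C (m : ℂ), X 1 + C (n : ℂ)] := by
    funext i
    fin_cases i <;> simp
  have hmap : MvPolynomial.map (algebraMap ℝ ℂ) (translate m n F) =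
      e (MvPolynomial.map (algebraMap ℝ ℂ) F) := by
    rw [translate, map_bind₁, hvec]
    rfl
  rw [hmap]
  exact (MulEquiv.irreducible_iff e).2 hF

/-- Transport of a smooth branch under an integer translation: `x ↦ g(x + m) - n` is a branch of
`F(x + m, y + n)`. [folklore] -/
theorem isSmoothBranch_translate {F : MvPolynomial (Fin 2) ℝ} {a b : ℝ} {g : ℝ → ℝ}
    (h : IsSmoothBranch F a b g) (m n : ℝ) :
    IsSmoothBranch (translate m n F) (a - m) (b - m) (fun x => g (x + m) - n) where
  lt := by linarith [h.lt]
  contDiffOn := by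
    have h1 : ContDiffOn ℝ ∞ (fun x => g (x + m)) (Set.Ioo (a - m) (b - m)) := by
      refine h.contDiffOn.comp (contDiffOn_id.add contDiffOn_const) ?_
      intro x hx
      exact ⟨by linarith [hx.1], by linarith [hx.2]⟩
    exact h1.sub contDiffOn_const
  abs_deriv_le := by
    intro x hx
    rw [deriv_sub_const, deriv_comp_add_const]
    exact h.abs_deriv_le (x + m) ⟨by linarith [hx.1], by linarith [hx.2]⟩
  eval_eq_zero := by
    intro x hx
    rw [eval_translate, sub_add_cancel]
    exact h.eval_eq_zero (x + m) ⟨by linarith [hx.1], by linarith [hx.2]⟩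

/-- Iterated derivatives of the translated branch. [folklore] -/
theorem iteratedDeriv_translate (g : ℝ → ℝ) (m n : ℝ) {k : ℕ} (hk : 1 ≤ k) (x : ℝ) :
    iteratedDeriv k (fun x => g (x + m) - n) x = iteratedDeriv k g (x + m) := by
  obtain ⟨k, rfl⟩ : ∃ k', k = k' + 1 := ⟨k - 1, by omega⟩
  rw [iteratedDeriv_succ', iteratedDeriv_succ']
  have : deriv (fun x => g (x + m) - n) = fun x => deriv g (x + m) := by
    funext t
    rw [deriv_sub_const, deriv_comp_add_const]
  rw [this, iteratedDeriv_comp_add_const]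

end Translate

end Literature.NumberTheory.DiophantineGeometry.Dioph
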